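import Literature.NumberTheory.EllipticCurves.PastenSpectralDegree
import Literature.NumberTheory.EllipticCurves.ModularCurveManinSemistableProofs
import Literature.NumberTheory.EllipticCurves.ModularCurveManinSemistableBridgeProofs
import Literature.NumberTheory.EllipticCurves.IsogenyDegreeLatticeIndexProofs
import Literature.NumberTheory.EllipticCurves.RationalIsogenyDegrees
import Literature.NumberTheory.EllipticCurves.ModularDegreeMinimal
import HarnessLib

/-!
# `PastenShimura2024_minimalDegree_le_163_mul`: reduction to the Mazur–Kenku isogeny bound in
# Néron-lattice form, and the degree formula `deg φ_D = [Λ_E : c Λ_f] · deg(X₀(N) → ℂ/Λ_f)`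

A proofs-only companion (theorems only: no definition, no named fact, nothing restated; D-0026) of
`PastenSpectralDegree.lean`, written by the seat of its named fact
`Literature.NumberTheory.EllipticCurves.ModularForms.PastenShimura2024_minimalDegree_le_163_mul`
(Pasten 2024, §3 p. 13: *"We have the standard modular parameterization
`φ = q_{1,N} j_N : X₀(N) → A_{1,N}` whose degree is `δ_{1,N}`. The degree of a minimal isogeny
between `A_{1,N}` and `E` is uniformly bounded by `163` thanks to Mazur [MazurRatIsog] and Kenku
[Kenku]"*; recorded over the tree as: for a datum `D` of minimal degree in the class at level `N`
and a datum `D'` of a *globally minimal* `W'` with the same newform, minimal among the data of `W'`,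
`deg φ_{D'} ≤ 163 · deg φ_D`).

What is proved here (sorry-free):

* `ModularParametrizationData.modularDegree_eq_card_ker_mul_of_eichlerShimuraMap` — **the degree
  formula for every datum**: `deg φ_D = #ker(z ↦ c z : ℂ/Λ_f → ℂ/Λ_E) · δ`, where `δ ≥ 1` is the
  degree of the Eichler–Shimura map `Y₀(N) → ℂ/Λ_f`, `Γ₀(N)τ ↦ 2πi ∫_{i∞}^τ f` (a theorem of the
  tree, `exists_degree_eichlerShimuraMap'`); the tree's `modularDegree_eq_card_ker_mul` is the same
  statement with `δ` presented through *optimal raw data*, which requires the Eichler–Shimura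
  construction with its period lattice; the present form is unconditional. In particular
  `δ ≤ deg φ_D` (`degree_eichlerShimuraMap_le_modularDegree`).
* `ModularParametrizationData.exists_datum_c_eq` — a datum may be given any other admissible
  nonzero integer Manin constant `k` (`k Λ_f ⊆ Λ_E`): same newform, lattice and uniformisation,
  degree supplied by `exists_modularDegree_holds`.
* `PastenShimura2024_minimalDegree_le_163_mul_of` — **the reduction**: the named fact follows from
  the hypothesis (`hMK`, spelled out in the statement, the trust base of the reduction — not a
  named fact of the tree) that *for every globally minimal elliptic `W'/ℚ` carrying a datum `D'` at
  level `N` there is an integer `k` with `k Λ_f ⊆ Λ_{E'}` such that the isogeny of complex tori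
  `z ↦ k z : ℂ/Λ_f → ℂ/Λ_{E'}` has kernel of order `≤ 163`*. This is Pasten's sentence in lattice
  form: `ℂ/Λ_f` is the optimal curve `A_{1,N}` with its optimal parametrisation
  `X₀(N) → ℂ/Λ_f` (Knapp 1993, Prop. 12.9(a) and p. 302; Cremona 1997, §2.6, §2.10); a `ℚ`-isogeny
  `A_{1,N} → E'` of minimal degree `d` is cyclic, so `d ∈ {1,…,19,21,25,27,37,43,67,163}`
  (Mazur 1978, Thm. 1; Kenku 1982; Silverman AEC IX.6, Ex. 6.4 — the tree's named fact
  `Literature.NumberTheory.EllipticCurves.mazurKenku_exists_cyclic_isogeny`); analytically it is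
  `z ↦ k z` with `k Λ_f ⊆ Λ_{E'}` and `#ker = [Λ_{E'} : k Λ_f] = d` (AEC Thm. VI.4.1); and `k ∈ ℤ`
  because `W'` is globally minimal: the composite `X₀(N) → A_{1,N} → E'` pulls the Néron
  differential `ω_{W'}` back to `k · 2πi f(τ) dτ`, and the pull-back of a Néron differential along a
  morphism `X₀(N)_ℚ → E'` has integral `q`-expansion at `∞` (Néron mapping property on the smooth
  locus of `X₀(N)_ℤ` and the Tate curve; Edixhoven 1991, Prop. 2, whose argument does not use
  optimality; Agashe–Ribet–Stein 2006, Thm. 2.2), whence `k · a₁(f) = k ∈ ℤ`. Proof of the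
  reduction: the datum `D'_k` of `W'` with Manin constant `k` has degree `#ker · δ ≤ 163 · δ`
  (degree formula), `δ ≤ deg φ_D` for the given `D` (degree formula again), and `D'` has minimal
  degree among the data of `W'`. (The global minimality hypothesis on `D` is not needed.)
* `PastenShimura2024_minimalDegree_le_163_mul_iff_of_latticeEq` — **granted** the Eichler–Shimura
  construction with its period lattice (hypothesis `hES`, verbatim that of the tree's
  `ModularParametrizationData.exists_optimalDatum`: a `ℚ`-model `W₀` of `ℂ/Λ_f` with
  `IsNewformOf W₀ f` and Néron-type lattice exactly `Λ_f`), the named fact is **equivalent** to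
  `hMK`: an optimal datum `D₀` exists and has minimal degree `δ` in the class
  (`modularDegree_le_of_isogenyMap_ker_eq_bot`), a minimal datum `D₁` of `W'` has degree
  `[Λ_{E'} : c₁ Λ_f] · δ` (`modularDegree_eq_card_ker_mul`), so the fact gives
  `[Λ_{E'} : c₁ Λ_f] ≤ 163` with the integer `k = c₁`. Hence `hMK` is exactly what a discharge must
  prove — neither weaker nor stronger — and its two printed ingredients are the theorem of
  Mazur–Kenku (unproved named fact of the tree) and the integrality of pulled-back Néron
  differentials (not in the tree).

* `PastenShimura2024_minimalDegree_le_163_mul_iff` — **the same equivalence with no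
  hypothesis**: the input `hES` is needed only at the newform `D'.f` of a datum, where it is a
  theorem of the tree (`ModularParametrizationData.exists_optimalDatum'`,
  `ModularCurveManinSemistableBridgeProofs`: the `ℚ`-model `E_f` of `ℂ/Λ_f` is `ℚ`-isogenous to
  `W'` along `z ↦ c' z`, hence has newform `f`). So the vendored fact and `hMK` are
  interderivable outright.
* `PastenShimura2024_minimalDegree_le_163_mul_of_mazurKenku` — **`hMK`, hence the fact, from
  the tree's Mazur–Kenku named fact `mazurKenku_exists_cyclic_isogeny` and ONE remaining input
  `hInt`** (integrality of rational multipliers `qΛ_f ⊆ Λ_{E'}` into the Néron lattice of a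
  globally minimal parametrised curve: Edixhoven 1991, Prop. 2 / Stevens 1989 — the pull-back of
  a Néron differential along any modular parametrisation has integral `q`-expansion; no statement
  in the tree): Mazur–Kenku is applied to the short models of `E_f` (`exists_latticeEq_model`) and
  `W'`, and the degree of the resulting `ℚ`-isogeny is the index of `Λ_{E'}` over `qΛ_f` for its
  rational multiplier `q` (`degree_eq_natCard_ker_mulQuotientMap_of_baseChange_eq_curve`,
  `IsogenyDegreeLatticeIndexProofs.lean`). A discharge of the fact is therefore
  `…_of_mazurKenku mazurKenku_exists_cyclic_isogeny_holds hInt_holds` once both inputs exist.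

## References

* H. Pasten, *Shimura curves and the abc conjecture*, J. Number Theory 254 (2024), 214–335 =
  arXiv:1705.09251: §3, p. 13. [PastenShimura2024]
* B. Mazur, *Rational isogenies of prime degree*, Invent. Math. 44 (1978), 129–162: Thm. 1.
  [Mazur1978]
* M. A. Kenku, *On the number of `ℚ`-isomorphism classes of elliptic curves in each `ℚ`-isogeny
  class*, J. Number Theory 15 (1982), 199–202. [Kenku1982]
* J. H. Silverman, *The Arithmetic of Elliptic Curves*, 2nd ed., GTM 106 (2009): IX.6 Example 6.4,
  Thm. VI.4.1. [SilvermanAEC2009]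
* B. Edixhoven, *On the Manin constants of modular elliptic curves*, in *Arithmetic algebraic
  geometry (Texel, 1989)*, Progr. Math. 89 (1991), 25–39: Prop. 2. [EdixhovenManin1991]
* A. Agashe, K. Ribet, W. A. Stein, *The Manin constant*, Pure Appl. Math. Q. 2 (2006), 617–636:
  Thm. 2.2. [AgasheRibetStein2006]
* A. W. Knapp, *Elliptic curves*, Math. Notes 40, Princeton 1993: Prop. 12.9(a), p. 302.
  [Knapp1993]
* G. Stevens, *Stickelberger elements and modular parametrizations of elliptic curves*, Invent.
  Math. 98 (1989), 75–106: §1 (the Manin constant of an arbitrary parametrisation; numbers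
  only, not held).
-/

noncomputable section

open scoped MatrixGroups ModularForm

open CongruenceSubgroup UpperHalfPlane

namespace Literature.NumberTheory.EllipticCurves.ModularForms

/-! ### Kernels of `z ↦ c z` do not depend on the presentation of the lattices -/

/-- The order of the kernel of `z ↦ c z : ℂ/Λ₁ → ℂ/Λ₂` depends only on the subgroups `Λ₁, Λ₂`
(transport along equalities of subgroups; used to pass between two data of one curve, which have
equal newforms and equal lattices). [folklore] -/
theorem natCard_ker_mulQuotientMap_congr {Λ₁ Λ₁' Λ₂ Λ₂' : AddSubgroup ℂ} (h₁ : Λ₁ = Λ₁')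
    (h₂ : Λ₂ = Λ₂') {c : ℂ} (hc : ∀ z ∈ Λ₁, c * z ∈ Λ₂) (hc' : ∀ z ∈ Λ₁', c * z ∈ Λ₂') :
    Nat.card (mulQuotientMap Λ₁ Λ₂ c hc).ker = Nat.card (mulQuotientMap Λ₁' Λ₂' c hc').ker := by
  subst h₁ h₂
  rfl

namespace ModularParametrizationData

variable {W : WeierstrassCurve ℚ} {N : ℕ} [NeZero N] (D : ModularParametrizationData W N)

/-! ### The degree formula `deg φ_D = [Λ_E : c Λ_f] · deg(Y₀(N) → ℂ/Λ_f)` -/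

/-- **Degree formula, unconditional form.** If the Eichler–Shimura map `Y₀(N) → ℂ/Λ_f` of the
newform `f` of a datum `D` has fibres of `d₀ ≥ 1` orbits off a finite subset of `ℂ/Λ_f` (such a
`d₀` exists: `exists_degree_eichlerShimuraMap'`), then the kernel of `D.isogenyMap : z ↦ c z` is
finite and `deg φ_D = #ker · d₀ = [Λ_E : c Λ_f] · d₀`: `φ_D` on `Y₀(N)` is the Eichler–Shimura map
followed by the isogeny (all fibres of size `#ker`, `natCard_fiber_mulQuotientMap`), fibre counts
multiply (`finite_setOf_natCard_fiber_comp_ne`), and two generic fibre counts on the infinite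
torus `ℂ/Λ_E` agree (`finite_setOf_natCard_fiberOrbits_ne`). Same argument as the tree's
`modularDegree_eq_card_ker_mul`, without optimal raw data (degrees multiply under composition,
`deg [z ↦ c z] = [Λ_E : c Λ_f]`: Diamond–Shurman 2005, §3.1 with §6.1; Silverman AEC VI.4.1).
[cite: SilvermanAEC2009, Thm. VI.4.1] -/
theorem modularDegree_eq_card_ker_mul_of_eichlerShimuraMap {f : CuspForm (Gamma0 N) 2}
    (hf : D.f = f) {d₀ : ℕ} (hd₀ : 0 < d₀)
    (hfin : {Q : ℂ ⧸ periodLattice f |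
        Nat.card {y : Y0 N // eichlerShimuraMap f y = Q} ≠ d₀}.Finite) :
    Finite D.isogenyMap.ker ∧ D.modularDegree = Nat.card D.isogenyMap.ker * d₀ := by
  subst hf
  have hf0 : D.f ≠ 0 := D.isNewformOf.1.ne_zero
  have hc0 := D.cast_c_ne_zero
  haveI := discreteTopology_periodLattice_of_mul_mem D.f hc0 D.smul_periodLattice_le
  obtain ⟨b, hb⟩ := exists_basis_span_eq_periodLattice D.f hf0
  haveI hfinker : Finite D.isogenyMap.ker :=
    finite_ker_mulQuotientMap b hb D.L D.smul_periodLattice_le hc0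
  refine ⟨hfinker, ?_⟩
  have hkpos : 0 < Nat.card D.isogenyMap.ker := Nat.card_pos
  have hk : ∀ P, Nat.card {Q // D.isogenyMap Q = P} = Nat.card D.isogenyMap.ker :=
    natCard_fiber_mulQuotientMap hc0
  have hS : ∀ Q ∉ {Q : ℂ ⧸ periodLattice D.f |
      Nat.card {y : Y0 N // eichlerShimuraMap D.f y = Q} ≠ d₀},
      Nat.card {y : Y0 N // eichlerShimuraMap D.f y = Q} = d₀ := fun Q hQ ↦
    not_not.mp hQ
  have key := finite_setOf_natCard_fiber_comp_ne (eichlerShimuraMap D.f) D.isogenyMap hk hkpos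
    hfin hS hd₀
  -- compare with `deg_spec` at a point of the infinite torus avoiding both exceptional sets
  haveI := D.infinite_torus
  obtain ⟨P, -, hP⟩ :=
    Set.infinite_univ.exists_notMem_finite (D.finite_setOf_natCard_fiberOrbits_ne.union key)
  simp only [Set.mem_union, Set.mem_setOf_eq, not_or, not_not] at hP
  obtain ⟨hP₁, hP₂⟩ := hP
  rw [← hP₁, ← hP₂]
  exact natCard_fiberOrbits_eq (fun y ↦ D.isogenyMap (eichlerShimuraMap D.f y)) P

/-- **`deg(Y₀(N) → ℂ/Λ_f) ≤ deg φ_D`**: the degree of the Eichler–Shimura map of the newform of a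
datum is at most the modular degree of the datum (`deg φ_D = [Λ_E : c Λ_f] · d₀` with
`[Λ_E : c Λ_f] ≥ 1`). [folklore] -/
theorem degree_eichlerShimuraMap_le_modularDegree {f : CuspForm (Gamma0 N) 2} (hf : D.f = f)
    {d₀ : ℕ} (hd₀ : 0 < d₀)
    (hfin : {Q : ℂ ⧸ periodLattice f |
        Nat.card {y : Y0 N // eichlerShimuraMap f y = Q} ≠ d₀}.Finite) :
    d₀ ≤ D.modularDegree := by
  obtain ⟨hfinker, hdeg⟩ := D.modularDegree_eq_card_ker_mul_of_eichlerShimuraMap hf hd₀ hfin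
  haveI := hfinker
  rw [hdeg]
  exact Nat.le_mul_of_pos_left _ Nat.card_pos

/-! ### Changing the Manin constant of a datum -/

/-- **A datum with another admissible Manin constant.** If `k ≠ 0` is an integer with
`k Λ_f ⊆ Λ_E` (`f`, `Λ_E` the newform and lattice of a datum `D` of `W` at level `N`), then `W`
has a datum at level `N` with the same newform, period pair and uniformisation and with Manin
constant `k`: the map `Γ₀(N)τ ↦ k · 2πi ∫_{i∞}^τ f (mod Λ_E)` has a degree
(`exists_modularDegree_holds`, Riemann surface theory of `X₀(N)`), transported to `E(ℂ)` along
`ℂ/Λ_E ≃ E(ℂ)` (`torusEquiv`, `finite_setOf_card_fiberOrbits_ne_iff`). (For a globally minimal `W`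
the admissible `k` are the Manin constants of the parametrisations `X₀(N) → ℂ/Λ_f → E` through the
isogenies `z ↦ k z`; Knapp 1993, p. 300.) [cite: Knapp1993, PDF p. 300] -/
theorem exists_datum_c_eq {k : ℤ} (hk0 : k ≠ 0)
    (hk : ∀ z ∈ periodLattice D.f, (k : ℂ) * z ∈ D.L.lattice) :
    ∃ Dk : ModularParametrizationData W N,
      Dk.f = D.f ∧ Dk.L = D.L ∧ Dk.uniformize = D.uniformize ∧ Dk.c = k := by
  obtain ⟨d, hd, hfin⟩ := exists_modularDegree_holds D.isNewformOf.1.ne_zero (L := D.L)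
    (c := (k : ℂ)) (Int.cast_ne_zero.mpr hk0) hk
  have he : ∀ x : ℂ, D.torusEquiv.toEquiv (x : ℂ ⧸ D.L.lattice.toAddSubgroup) = D.uniformize x :=
    fun _ ↦ rfl
  have key := (finite_setOf_card_fiberOrbits_ne_iff D.torusEquiv.toEquiv
    (fun τ : ℍ ↦ (((k : ℂ) * eichlerIntegral D.f τ : ℂ) : ℂ ⧸ D.L.lattice.toAddSubgroup)) d).mpr
    hfin
  simp only [he] at key
  exact ⟨{ D with
      c := k
      smul_periodLattice_le := hk
      deg := d
      deg_pos := hd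
      deg_spec := key }, rfl, rfl, rfl, rfl⟩

end ModularParametrizationData

/-! ### The reduction of `PastenShimura2024_minimalDegree_le_163_mul` -/

section Reduction

/-- **Reduction of the vendored fact to the Mazur–Kenku bound in Néron-lattice form.** Assume
(`hMK`): for every globally minimal model `W'/ℚ` of an elliptic curve carrying a parametrisation
datum `D'` at level `N` (newform `f`, Néron lattice `Λ_{E'}`), there is an integer `k` with
`k Λ_f ⊆ Λ_{E'}` such that the isogeny `z ↦ k z : ℂ/Λ_f → ℂ/Λ_{E'}` has kernel of order `≤ 163`
— i.e. `E'` is reached from the optimal curve `A_{1,N} = ℂ/Λ_f` by an isogeny of degree `≤ 163`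
(Pasten 2024, §3 p. 13, from Mazur 1978, Thm. 1 and Kenku 1982: a minimal, hence cyclic,
`ℚ`-isogeny has degree in `{1,…,19,21,25,27,37,43,67,163}`, Silverman AEC IX.6 Ex. 6.4) which,
composed with `X₀(N) → A_{1,N}`, pulls the Néron differential of `W'` back to an *integral*
multiple `k · 2πi f dτ` (Edixhoven 1991, Prop. 2; Agashe–Ribet–Stein 2006, Thm. 2.2: integrality of
the `q`-expansion of a pulled-back Néron differential, by the Néron mapping property on the smooth
locus of `X₀(N)_ℤ`). Then `PastenShimura2024_minimalDegree_le_163_mul` holds: with `δ` the degree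
of `Y₀(N) → ℂ/Λ_f` (`exists_degree_eichlerShimuraMap'`), the datum of `W'` with Manin constant `k`
(`exists_datum_c_eq`) has degree `#ker · δ ≤ 163 · δ`
(`modularDegree_eq_card_ker_mul_of_eichlerShimuraMap`), `δ ≤ deg φ_D`
(`degree_eichlerShimuraMap_le_modularDegree`), and `D'` has minimal degree among the data of `W'`.
The hypothesis `hMK` is the open input — the trust base of this reduction — not a named fact of the
tree. [cite: PastenShimura2024, §3 p. 13] [cite: Mazur1978, Thm. 1] [cite: Kenku1982]
[cite: EdixhovenManin1991, Prop. 2] -/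
theorem PastenShimura2024_minimalDegree_le_163_mul_of
    (hMK : ∀ {N : ℕ} [NeZero N] {W' : WeierstrassCurve ℚ} [W'.IsElliptic] [W'.IsGloballyMinimal]
      (D' : ModularParametrizationData W' N),
      ∃ (k : ℤ) (hk : ∀ z ∈ periodLattice D'.f, (k : ℂ) * z ∈ D'.L.lattice), k ≠ 0 ∧
        Nat.card (mulQuotientMap (periodLattice D'.f) D'.L.lattice.toAddSubgroup (k : ℂ) hk).ker
          ≤ 163) :
    PastenShimura2024_minimalDegree_le_163_mul := by
  intro N _ W W' _ _ _ D D' hf _ hmin'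
  -- the degree `δ` of the Eichler–Shimura map of `f = D'.f = D.f`
  haveI := discreteTopology_periodLattice_of_mul_mem D'.f D'.cast_c_ne_zero
    D'.smul_periodLattice_le
  obtain ⟨δ, hδ, hfinδ⟩ := exists_degree_eichlerShimuraMap' (N := N) D'.isNewformOf.1.ne_zero
  -- `δ ≤ deg φ_D`
  have hδD : δ ≤ D.modularDegree := D.degree_eichlerShimuraMap_le_modularDegree hf.symm hδ hfinδ
  -- the datum of `W'` with Manin constant `k`, of degree `#ker · δ ≤ 163 · δ`
  obtain ⟨k, hk, hk0, hk163⟩ := hMK D'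
  obtain ⟨d, hd, hfin⟩ := exists_modularDegree_holds D'.isNewformOf.1.ne_zero (L := D'.L)
    (c := (k : ℂ)) (Int.cast_ne_zero.mpr hk0) hk
  have he : ∀ x : ℂ, D'.torusEquiv.toEquiv (x : ℂ ⧸ D'.L.lattice.toAddSubgroup) = D'.uniformize x :=
    fun _ ↦ rfl
  have key := (finite_setOf_card_fiberOrbits_ne_iff D'.torusEquiv.toEquiv
    (fun τ : ℍ ↦ (((k : ℂ) * eichlerIntegral D'.f τ : ℂ) : ℂ ⧸ D'.L.lattice.toAddSubgroup)) d).mpr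
    hfin
  simp only [he] at key
  let Dk : ModularParametrizationData W' N :=
    { D' with
      c := k
      smul_periodLattice_le := hk
      deg := d
      deg_pos := hd
      deg_spec := key }
  obtain ⟨hfinK, hdegK⟩ := Dk.modularDegree_eq_card_ker_mul_of_eichlerShimuraMap rfl hδ hfinδ
  have hkerK : Nat.card Dk.isogenyMap.ker ≤ 163 := hk163
  calc D'.modularDegree ≤ Dk.modularDegree := hmin' Dk
    _ = Nat.card Dk.isogenyMap.ker * δ := hdegK
    _ ≤ 163 * δ := Nat.mul_le_mul_right δ hkerK
    _ ≤ 163 * D.modularDegree := Nat.mul_le_mul_left 163 hδD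

/-- **Granted the Eichler–Shimura construction with its period lattice, the vendored fact is
equivalent to the Mazur–Kenku bound in Néron-lattice form.** Assume (`hES`, verbatim the
hypothesis of `ModularParametrizationData.exists_optimalDatum`: Knapp 1993, Thm. 11.74 (c), (d)
with Prop. 12.9(a) and p. 302; Cremona 1997, §2.14) a `ℚ`-model `W₀` of the optimal curve
`ℂ/Λ_f` with `IsNewformOf W₀ f` and Néron-type lattice exactly `Λ_f`, for every newform `f` with
integer coefficients. Then `PastenShimura2024_minimalDegree_le_163_mul` implies `hMK` (and
conversely, `PastenShimura2024_minimalDegree_le_163_mul_of`): given a globally minimal elliptic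
`W'` with a datum `D'`, an optimal datum `D₀` with newform `f = D'.f` exists
(`exists_optimalDatum`) and has minimal degree in the class
(`modularDegree_le_of_isogenyMap_ker_eq_bot`); a datum `D₁` of `W'` of minimal degree
(`exists_minimal_datum`) has the same newform (`IsNewformOf.unique`) and lattice
(`IsNeronLatticeOf.lattice_eq`) as `D'` and degree `[Λ_{E'} : c₁ Λ_f] · deg φ_{D₀}`
(`modularDegree_eq_card_ker_mul`); the fact gives `deg φ_{D₁} ≤ 163 · deg φ_{D₀}`, hence
`[Λ_{E'} : c₁ Λ_f] ≤ 163` with the integer `k = c₁`. So `hMK` is exactly what a discharge of the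
fact must prove. [cite: PastenShimura2024, §3 p. 13]
[cite: Knapp1993, Thm. 11.74 (c)(d) with Prop. 12.9(a) and p. 302] -/
theorem PastenShimura2024_minimalDegree_le_163_mul_iff_of_latticeEq
    (hES : ∀ {N : ℕ} [NeZero N] {f : CuspForm (Gamma0 N) 2}, IsNewform0 f →
      (∀ n : ℕ, ∃ a : ℤ, cuspCoeff f n = a) →
      ∃ (W₀ : WeierstrassCurve ℚ) (_ : W₀.IsElliptic), IsNewformOf W₀ f ∧
        ∃ L₀ : PeriodPair, IsNeronLatticeOf (W₀.baseChange ℂ) L₀ ∧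
          (L₀.lattice : Set ℂ) = periodLattice f) :
    PastenShimura2024_minimalDegree_le_163_mul ↔
      ∀ {N : ℕ} [NeZero N] {W' : WeierstrassCurve ℚ} [W'.IsElliptic] [W'.IsGloballyMinimal]
        (D' : ModularParametrizationData W' N),
        ∃ (k : ℤ) (hk : ∀ z ∈ periodLattice D'.f, (k : ℂ) * z ∈ D'.L.lattice), k ≠ 0 ∧
          Nat.card (mulQuotientMap (periodLattice D'.f) D'.L.lattice.toAddSubgroup (k : ℂ) hk).ker
            ≤ 163 := by
  refine ⟨fun h N _ W' _ _ D' ↦ ?_, fun hMK ↦ PastenShimura2024_minimalDegree_le_163_mul_of hMK⟩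
  -- an optimal datum `D₀` with newform `D'.f`, of minimal degree in the class
  obtain ⟨W₀, hW₀, D₀, hf₀, h₀⟩ := D'.exists_optimalDatum hES
  haveI := hW₀
  have hker₀ : D₀.isogenyMap.ker = ⊥ := D₀.isogenyMap_ker_eq_bot_iff.mpr h₀
  have hmin₀ : ∀ (W'' : WeierstrassCurve ℚ) [W''.IsElliptic]
      (D'' : ModularParametrizationData W'' N), D''.f = D₀.f →
        D₀.modularDegree ≤ D''.modularDegree := fun W'' _ D'' hD'' ↦
    D₀.modularDegree_le_of_isogenyMap_ker_eq_bot hker₀ D'' hD''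
  -- a datum `D₁` of `W'` of minimal degree; same newform and lattice as `D'`
  obtain ⟨D₁, -, hD₁⟩ := exists_minimal_datum (W := W') (N := N) ⟨D'⟩
  have hf₁' : D₁.f = D'.f := D₁.isNewformOf.unique D'.isNewformOf
  have hf₁ : D₁.f = D₀.f := hf₁'.trans hf₀.symm
  have hΛ₁ : D₁.L.lattice = D'.L.lattice :=
    IsNeronLatticeOf.lattice_eq D₁.isNeronLattice D'.isNeronLattice
  -- the fact: `deg φ_{D₁} ≤ 163 · deg φ_{D₀}`; the degree formula: `deg φ_{D₁} = #ker · deg φ_{D₀}`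
  have h163 : D₁.modularDegree ≤ 163 * D₀.modularDegree := h N W₀ W' D₀ D₁ hf₁ hmin₀ hD₁
  have hinj : Function.Injective D₀.isogenyMap := (AddMonoidHom.ker_eq_bot_iff _).mp hker₀
  obtain ⟨hfin₁, hdeg₁⟩ := D₁.modularDegree_eq_card_ker_mul hf₁ D₀.smul_periodLattice_le hinj
    D₀.deg_pos D₀.finite_setOf_natCard_fiberOrbits_ne
  have hcard : Nat.card D₁.isogenyMap.ker ≤ 163 := by
    refine Nat.le_of_mul_le_mul_right ?_ D₀.deg_pos
    calc Nat.card D₁.isogenyMap.ker * D₀.modularDegree = D₁.modularDegree := hdeg₁.symm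
      _ ≤ 163 * D₀.modularDegree := h163
  -- transport `k = c₁` to the newform and lattice of `D'`
  have hk : ∀ z ∈ periodLattice D'.f, ((D₁.c : ℤ) : ℂ) * z ∈ D'.L.lattice := fun z hz ↦ by
    rw [← hΛ₁]
    exact D₁.smul_periodLattice_le z (hf₁' ▸ hz)
  refine ⟨D₁.c, hk, D₁.maninConstant_ne_zero_holds, ?_⟩
  have hΛ₁' : D₁.L.lattice.toAddSubgroup = D'.L.lattice.toAddSubgroup := by rw [hΛ₁]
  rw [← natCard_ker_mulQuotientMap_congr (congrArg periodLattice hf₁') hΛ₁'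
    D₁.smul_periodLattice_le hk]
  exact hcard


/-- **The vendored fact is equivalent to the Mazur–Kenku bound in Néron-lattice form,
unconditionally.** `PastenShimura2024_minimalDegree_le_163_mul` holds iff (`hMK`) for every
globally minimal model `W'/ℚ` of an elliptic curve carrying a parametrisation datum `D'` at level
`N` there is an integer `k ≠ 0` with `k Λ_f ⊆ Λ_{E'}` such that `z ↦ k z : ℂ/Λ_f → ℂ/Λ_{E'}` has
kernel of order `≤ 163`. `←` is `PastenShimura2024_minimalDegree_le_163_mul_of`; `→` is the
argument of `PastenShimura2024_minimalDegree_le_163_mul_iff_of_latticeEq` with its input `hES`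
supplied at the newform `D'.f` by the tree's `ModularParametrizationData.exists_optimalDatum'`
(an optimal datum `D₀`, `Λ_{E₀} = c₀ Λ_f`, of a `ℚ`-model of `ℂ/Λ_f` with the same newform exists
for every parametrised curve: Knapp 1993, Thm. 11.74 (c)(d), Prop. 12.9 (a), obtained in
`ModularCurveManinSemistableBridgeProofs` from the modularity of `W'` and the analytic isogeny
`z ↦ c' z`): `D₀` has minimal degree in the class (`modularDegree_le_of_isogenyMap_ker_eq_bot`), a
minimal datum `D₁` of `W'` has the newform and lattice of `D'` and degree
`[Λ_{E'} : c₁ Λ_f] · deg φ_{D₀}` (`modularDegree_eq_card_ker_mul`), and the fact gives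
`[Λ_{E'} : c₁ Λ_f] ≤ 163` with `k = c₁ ∈ ℤ`. Consequently a discharge of the fact must prove
exactly `hMK`, whose printed ingredients are Mazur–Kenku (Mazur 1978, Thm. 1; Kenku 1982; the
tree's unproved named fact `Literature.NumberTheory.EllipticCurves.mazurKenku_exists_cyclic_isogeny`)
and the integrality of the pull-back of a Néron differential along `X₀(N) → E'` (Edixhoven 1991,
Prop. 2), not in the tree. [cite: PastenShimura2024, §3 p. 13]
[cite: Knapp1993, Thm. 11.74 (c)(d) with Prop. 12.9(a) and p. 302] -/
theorem PastenShimura2024_minimalDegree_le_163_mul_iff :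
    PastenShimura2024_minimalDegree_le_163_mul ↔
      ∀ {N : ℕ} [NeZero N] {W' : WeierstrassCurve ℚ} [W'.IsElliptic] [W'.IsGloballyMinimal]
        (D' : ModularParametrizationData W' N),
        ∃ (k : ℤ) (hk : ∀ z ∈ periodLattice D'.f, (k : ℂ) * z ∈ D'.L.lattice), k ≠ 0 ∧
          Nat.card (mulQuotientMap (periodLattice D'.f) D'.L.lattice.toAddSubgroup (k : ℂ) hk).ker
            ≤ 163 := by
  refine ⟨fun h N _ W' _ _ D' ↦ ?_, fun hMK ↦ PastenShimura2024_minimalDegree_le_163_mul_of hMK⟩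
  -- an optimal datum `D₀` with newform `D'.f`, of minimal degree in the class (unconditionally)
  obtain ⟨W₀, hW₀, D₀, hf₀, h₀⟩ := D'.exists_optimalDatum'
  haveI := hW₀
  have hker₀ : D₀.isogenyMap.ker = ⊥ := D₀.isogenyMap_ker_eq_bot_iff.mpr h₀
  have hmin₀ : ∀ (W'' : WeierstrassCurve ℚ) [W''.IsElliptic]
      (D'' : ModularParametrizationData W'' N), D''.f = D₀.f →
        D₀.modularDegree ≤ D''.modularDegree := fun W'' _ D'' hD'' ↦
    D₀.modularDegree_le_of_isogenyMap_ker_eq_bot hker₀ D'' hD''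
  -- a datum `D₁` of `W'` of minimal degree; same newform and lattice as `D'`
  obtain ⟨D₁, -, hD₁⟩ := exists_minimal_datum (W := W') (N := N) ⟨D'⟩
  have hf₁' : D₁.f = D'.f := D₁.isNewformOf.unique D'.isNewformOf
  have hf₁ : D₁.f = D₀.f := hf₁'.trans hf₀.symm
  have hΛ₁ : D₁.L.lattice = D'.L.lattice :=
    IsNeronLatticeOf.lattice_eq D₁.isNeronLattice D'.isNeronLattice
  -- the fact: `deg φ_{D₁} ≤ 163 · deg φ_{D₀}`; the degree formula: `deg φ_{D₁} = #ker · deg φ_{D₀}`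
  have h163 : D₁.modularDegree ≤ 163 * D₀.modularDegree := h N W₀ W' D₀ D₁ hf₁ hmin₀ hD₁
  have hinj : Function.Injective D₀.isogenyMap := (AddMonoidHom.ker_eq_bot_iff _).mp hker₀
  obtain ⟨hfin₁, hdeg₁⟩ := D₁.modularDegree_eq_card_ker_mul hf₁ D₀.smul_periodLattice_le hinj
    D₀.deg_pos D₀.finite_setOf_natCard_fiberOrbits_ne
  have hcard : Nat.card D₁.isogenyMap.ker ≤ 163 := by
    refine Nat.le_of_mul_le_mul_right ?_ D₀.deg_pos
    calc Nat.card D₁.isogenyMap.ker * D₀.modularDegree = D₁.modularDegree := hdeg₁.symm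
      _ ≤ 163 * D₀.modularDegree := h163
  -- transport `k = c₁` to the newform and lattice of `D'`
  have hk : ∀ z ∈ periodLattice D'.f, ((D₁.c : ℤ) : ℂ) * z ∈ D'.L.lattice := fun z hz ↦ by
    rw [← hΛ₁]
    exact D₁.smul_periodLattice_le z (hf₁' ▸ hz)
  refine ⟨D₁.c, hk, D₁.maninConstant_ne_zero_holds, ?_⟩
  have hΛ₁' : D₁.L.lattice.toAddSubgroup = D'.L.lattice.toAddSubgroup := by rw [hΛ₁]
  rw [← natCard_ker_mulQuotientMap_congr (congrArg periodLattice hf₁') hΛ₁'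
    D₁.smul_periodLattice_le hk]
  exact hcard


open _root_.WeierstrassCurve in
/-- **Reduction to the Mazur–Kenku named fact and the integrality of rational multipliers.**
`PastenShimura2024_minimalDegree_le_163_mul` follows from
(1) the tree's named fact `Literature.NumberTheory.EllipticCurves.mazurKenku_exists_cyclic_isogeny`
(Mazur 1978, Thm. 1; Kenku 1982; Silverman AEC IX.6 Ex. 6.4: `ℚ`-isogenous elliptic curves are
joined by a cyclic `ℚ`-isogeny of degree in `{1,…,19,21,25,27,37,43,67,163}`), and
(2) (`hInt`) the integrality of rational multipliers into the Néron lattice of a globally minimal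
parametrised curve: for a globally minimal elliptic `W'/ℚ` with a datum `D'` (newform `f`, Néron
lattice `Λ_{E'}`) and `q ∈ ℚ` with `qΛ_f ⊆ Λ_{E'}`, `q ∈ ℤ` — the isogeny `z ↦ qz : E_f → E'` is
defined over `ℚ` (`isIsogenous_of_forall_mul_mem_lattice`), so `X₀(N) → E_f → E'` is a modular
parametrisation of `E'` pulling its Néron differential back to `q · 2πi f(τ)dτ`, whose
`q`-expansion `q · Σ aₙ qⁿ` (`a₁ = 1`) is integral by the Néron mapping property on the smooth
locus of `X₀(N)_ℤ` (Edixhoven 1991, Prop. 2, whose argument does not use optimality;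
Agashe–Ribet–Stein 2006, Thm. 2.2; Stevens 1989, §1); this input is not in the tree and is
the hypothesis here. Proof: by `PastenShimura2024_minimalDegree_le_163_mul_of` it suffices to find,
for such `W', D'`, an integer `k` with `kΛ_f ⊆ Λ_{E'}` and `#ker(z ↦ kz) ≤ 163`. The `ℚ`-model
`W₀ = E_f` of `ℂ/Λ_f` (`exists_latticeEq_model`) is `ℚ`-isogenous to `W'` along `z ↦ c'z`; the
short models `C₀ • W₀`, `C' • W'` are `E_{Λ_f}`, `E_{Λ_{E'}}` after base change
(`shortModel_baseChange_eq_curve`); Mazur–Kenku gives a `ℚ`-isogeny `ψ : C₀ • W₀ → C' • W'` of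
degree `≤ 163`; its rational multiplier `q` satisfies `qΛ_f ⊆ Λ_{E'}` and
`#ker(z ↦ qz) = deg ψ ≤ 163` (`degree_eq_natCard_ker_mulQuotientMap_of_baseChange_eq_curve`);
and `q = k ∈ ℤ` by `hInt`. [cite: PastenShimura2024, §3 p. 13] [cite: Mazur1978, Thm. 1]
[cite: Kenku1982] [cite: EdixhovenManin1991, Prop. 2] -/
theorem PastenShimura2024_minimalDegree_le_163_mul_of_mazurKenku
    (hMK : mazurKenku_exists_cyclic_isogeny)
    (hInt : ∀ {N : ℕ} [NeZero N] {W' : WeierstrassCurve ℚ} [W'.IsElliptic] [W'.IsGloballyMinimal]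
      (D' : ModularParametrizationData W' N) (q : ℚ),
      (∀ z ∈ periodLattice D'.f, (q : ℂ) * z ∈ D'.L.lattice) → ∃ k : ℤ, (k : ℚ) = q) :
    PastenShimura2024_minimalDegree_le_163_mul := by
  refine PastenShimura2024_minimalDegree_le_163_mul_of fun {N} _ {W'} _ _ D' ↦ ?_
  -- the `ℚ`-model `W₀ = E_f` of `ℂ/Λ_f`, with Néron-type lattice exactly `Λ_f`
  obtain ⟨W₀, hW₀, -, L₀, hL₀, hΛ⟩ := D'.exists_latticeEq_model
  haveI := hW₀
  have hmem : ∀ z, z ∈ L₀.lattice ↔ z ∈ periodLattice D'.f := fun z ↦ by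
    rw [← SetLike.mem_coe, hΛ, SetLike.mem_coe]
  -- `W₀ ~ W'` over `ℚ`, along `z ↦ c' z`
  have hc : (D'.c : ℚ) ≠ 0 := by exact_mod_cast D'.maninConstant_ne_zero_holds
  have hle : ∀ z ∈ L₀.lattice, ((D'.c : ℚ) : ℂ) * z ∈ D'.L.lattice := fun z hz ↦ by
    rw [Rat.cast_intCast]
    exact D'.smul_periodLattice_le z ((hmem z).mp hz)
  have hiso : IsIsogenous W₀ W' :=
    isIsogenous_of_forall_mul_mem_lattice hL₀.1 hL₀.2 D'.isNeronLattice.1 D'.isNeronLattice.2 hc hle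
  -- the short models are `E_{Λ_f}`, `E_{Λ_{E'}}` after base change, and are `ℚ`-isogenous
  set C₀ : VariableChange ℚ := ⟨1, -W₀.b₂ / 12, -W₀.a₁ / 2, W₀.a₁ * W₀.b₂ / 24 - W₀.a₃ / 2⟩
    with hC₀
  set C' : VariableChange ℚ := ⟨1, -W'.b₂ / 12, -W'.a₁ / 2, W'.a₁ * W'.b₂ / 24 - W'.a₃ / 2⟩
    with hC'
  have hE₀ : (C₀ • W₀).baseChange ℂ = L₀.curve := shortModel_baseChange_eq_curve W₀ hL₀
  have hE' : (C' • W').baseChange ℂ = D'.L.curve := shortModel_baseChange_eq_curve W' D'.isNeronLattice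
  have h : IsIsogenous (C₀ • W₀) (C' • W') :=
    (isIsogenous_of_smul W₀ C₀).trans' (hiso.trans' (isIsogenous_smul W' C'))
  -- Mazur–Kenku: a cyclic `ℚ`-isogeny `ψ` of degree `≤ 163`
  obtain ⟨ψ, -, hdeg⟩ := hMK (C₀ • W₀) (C' • W') h
  have h163 : ψ.degree ≤ 163 := le_of_mem_kenkuDegrees hdeg
  -- its rational multiplier `q`: `qΛ_f ⊆ Λ_{E'}`, `#ker(z ↦ qz) = deg ψ`
  obtain ⟨q, hq0, hq, hdegq⟩ :=
    degree_eq_natCard_ker_mulQuotientMap_of_baseChange_eq_curve ψ hE₀ hE'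
  have hq' : ∀ z ∈ periodLattice D'.f, (q : ℂ) * z ∈ D'.L.lattice := fun z hz ↦
    hq z ((hmem z).mpr hz)
  -- `q = k ∈ ℤ`
  obtain ⟨k, rfl⟩ := hInt D' q hq'
  have hk : ∀ z ∈ periodLattice D'.f, (k : ℂ) * z ∈ D'.L.lattice := fun z hz ↦ by
    have := hq' z hz
    rwa [Rat.cast_intCast] at this
  refine ⟨k, hk, by exact_mod_cast hq0, ?_⟩
  have hΛ' : L₀.lattice.toAddSubgroup = periodLattice D'.f :=
    SetLike.coe_injective (by rw [Submodule.coe_toAddSubgroup, hΛ])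
  have hcast : ((k : ℚ) : ℂ) = (k : ℂ) := Rat.cast_intCast k
  calc Nat.card (mulQuotientMap (periodLattice D'.f) D'.L.lattice.toAddSubgroup (k : ℂ) hk).ker
      = Nat.card (mulQuotientMap L₀.lattice.toAddSubgroup D'.L.lattice.toAddSubgroup
          ((k : ℚ) : ℂ) hq).ker := by
        simp only [hcast]
        exact (natCard_ker_mulQuotientMap_congr hΛ' rfl (fun z hz ↦ hk z (hΛ' ▸ hz)) hk).symm
    _ = ψ.degree := hdegq.symm
    _ ≤ 163 := h163

end Reduction

end Literature.NumberTheory.EllipticCurves.ModularForms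

end
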